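import Mathlib
import Literature.AlgebraicGeometry.Resolution.CobordantGame
import Literature.AlgebraicGeometry.Resolution.FormalCoordinateChange
import Summits.ResolutionOfSingularities.ResolutionOfSingularities.Theorems.WeightedInvariantGlobalizeLocalDropRegularGerms
import Summits.ResolutionOfSingularities.ResolutionOfSingularities.Theorems.WeightedInvariantLocalWeightedDropPlaneBranchDropOfCount
import Summits.ResolutionOfSingularities.ResolutionOfSingularities.Theorems.WeightedInvariantLocalWeightedDropTerminalDoublePointsAux

/-!
# `WeightedInvariant.LocalWeightedDrop`, line `hasse-ridge-face-selection`: the TERMINAL double points `y² + A₀(x₀,x₁)`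

Crux item stmt-ResolutionOfSingularities-8899 `LocalWeightedDrop` (route `ResolutionOfSingularities/WeightedInvariant`),
serving the door `WeightedConstruction` stmt-ResolutionOfSingularities-0571.  [OURS · L1 W4.3, chain w43, stub worker 3
(gen 2): the TERMINAL CASES piece S2iT `stub_charTwoInseparableTerminalWon` of the planner's skeleton draft v21 for CORE W″
piece S2 `stub_charTwoDoublePointSurfaceWon`; replaces the role of the «monomial case / small residual case» of a
surface-resolution algorithm; NOT a statement of any manuscript.]

THE RESULT (`terminalDoublePointWon`, every characteristic `p`, every field `k` of characteristic `p`; only the singular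
germs in ONE variable are assumed won).  The monic double point `y² + A₀(x₀, x₁)` (`y = X (Fin.last 2)`, `A₀` embedded along
`Fin.succAboveEmb (Fin.last 2)`) is won in the local weighted resolution game (`CobordantGame.Won k 3`) whenever `A₀` is
TERMINAL:
* BINOMIAL CASE (`binomialDoublePointWon`): `A₀ = x₀^r · x₁^s · U` with `U(0) ≠ 0` and `(r, s) ∉ 2ℕ × 2ℕ`;
* SMALL RESIDUAL CASE (`smallResidualDoublePointWon`): `A₀ = x_i^{2m} · g` with `m ≥ 1` and `ord g = 1`.

THE STRATEGY is the classical one and never meets a wild point: blow up the curve `V(x_i, y)` (the landed brick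
`won_monic_of_curveBlowup`, weights `1` at `x_i` and `y`, `0` elsewhere — every exceptional point is tame) as long as
`x_i² ∣ A₀`; the only singular successors sit over `γ = 0`, and their slice is again a monic double point `y² + A₀'` with
`A₀' = c_i² · A₀'(c_i x₀, x₁)` resp. `c_i² · A₀'(x₁, c_i x₀)` (`TerminalDoublePoint.slice_subst_chart`: the composite
«curve chart, then slice» IS the linear substitution `x_i ↦ c_i x₀`, `x_{1-i} ↦ x₁`), so the exponent pair drops by `2`
(`(r, s) ↦ (r - 2, s)` or `(s - 2, r)`, parity class preserved; `m ↦ m - 1`, the order-`1` factor transported linearly).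
At the bottom: `(r, s) ∈ {(1,0), (0,1)}` or `m = 0` — the slice has a linear term, Refuter has no move
(`wonBy_zero_of_not_isSingular`); `(r, s) = (1, 1)` — hyperbolic quadric `y² + c·x₀x₁`, won by the landed
`TangentConeCut.hyperbolicStartsWon` from the one-variable germs.  `(0, 0)` and every both-even pair are excluded (they are the
non-terminal `y² + unit · square` shapes of the reduction piece S2iM).

The last theorem `stub_charTwoInseparableTerminalWon` is the v21 stub BY NAME AND SIGNATURE (characteristic `2`, `k`
algebraically closed, all singular germs in `≤ 2` variables won — only the one-variable ones are used).
-/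

set_option linter.dupNamespace false -- mandated namespace of this single-conjunct summit

namespace Summit.ResolutionOfSingularities.ResolutionOfSingularities.Theorems

open Literature.AlgebraicGeometry.Resolution
open Literature.AlgebraicGeometry.Resolution.CobordantGame

namespace TerminalDoublePoint

open MvPowerSeries

variable {k : Type} [Field k]

/-! ### The binomial case -/

/-- Parity bookkeeping: `(r + 2, s) ∉ 2ℕ²` forces `r + s ≥ 1`. -/
theorem one_le_add_of_not_both_even {r s : ℕ} (h : ¬ (2 ∣ r + 2 ∧ 2 ∣ s)) : 1 ≤ r + s := by
  rcases Nat.eq_zero_or_pos (r + s) with h0 | h0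
  · exfalso
    obtain ⟨hr, hs⟩ : r = 0 ∧ s = 0 := by omega
    subst hr
    subst hs
    exact h ⟨⟨1, rfl⟩, dvd_zero 2⟩
  · exact h0

/-- THE BINOMIAL CASE (every characteristic): `y² + x₀^r x₁^s · U`, `U(0) ≠ 0`, `(r, s)` not both even, is won — given only
the singular germs in one variable.  Induction on `r + s` along the curve steps. -/
theorem binomialDoublePointWon (p : ℕ) (hp : p.Prime) (k : Type) [Field k] [CharP k p]
    (hlow : ∀ g : MvPowerSeries (Fin 1) k, CobordantGame.IsSingular k g → CobordantGame.Won k 1 g) :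
    ∀ (N r s : ℕ) (U : MvPowerSeries (Fin 2) k), r + s ≤ N → constantCoeff U ≠ 0 → ¬ (2 ∣ r ∧ 2 ∣ s) →
      CobordantGame.Won k 3 (X (Fin.last 2) ^ 2 + rename (Fin.succAboveEmb (Fin.last 2)) (X 0 ^ r * X 1 ^ s * U)) := by
  intro N
  induction N with
  | zero =>
    intro r s U hN _ hpar
    obtain ⟨hr, hs⟩ : r = 0 ∧ s = 0 := by omega
    subst hr
    subst hs
    exact absurd ⟨dvd_zero 2, dvd_zero 2⟩ hpar
  | succ N ih =>
    intro r s U hN hU hpar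
    by_cases hr : 2 ≤ r
    · -- blow up `V(x₀, y)`
      obtain ⟨r', rfl⟩ : ∃ r', r = r' + 2 := ⟨r - 2, by omega⟩
      have hpar' : ¬ (2 ∣ r' ∧ 2 ∣ s) := fun h => hpar ⟨dvd_add h.1 (dvd_refl 2), h.2⟩
      refine won_dp_of_curveStep p hp k 0 _ (X 0 ^ r' * X 1 ^ s * U) (by ring) ?_ ?_
      · have h1 := one_le_add_of_not_both_even hpar
        have hord := PlaneBranchDropOfCount.order_unit_monomial hU r' s
        rw [show U * X 0 ^ r' * X 1 ^ s = X 0 ^ r' * X 1 ^ s * U by ring] at hord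
        exact one_le_order_iff_constCoeff_eq_zero.mp (by rw [hord]; exact_mod_cast h1)
      · intro c hc _
        rw [subst_rho_zero_unitMonomial,
          show C (c ^ 2) * (X 0 ^ r' * X 1 ^ s * (C (c ^ r') *
              subst (fun l : Fin 2 => if l = 0 then C c * X 0 else (X 1 : MvPowerSeries (Fin 2) k)) U)) =
            X 0 ^ r' * X 1 ^ s * (C (c ^ 2) * C (c ^ r') *
              subst (fun l : Fin 2 => if l = 0 then C c * X 0 else (X 1 : MvPowerSeries (Fin 2) k)) U) by ring]
        refine ih r' s _ (by omega) ?_ hpar'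
        rw [map_mul, map_mul, constantCoeff_C, constantCoeff_C, constantCoeff_subst_rho]
        exact mul_ne_zero (mul_ne_zero (pow_ne_zero _ hc) (pow_ne_zero _ hc)) hU
    · by_cases hs : 2 ≤ s
      · -- blow up `V(x₁, y)`
        obtain ⟨s', rfl⟩ : ∃ s', s = s' + 2 := ⟨s - 2, by omega⟩
        have hpar' : ¬ (2 ∣ s' ∧ 2 ∣ r) := fun h => hpar ⟨h.2, dvd_add h.1 (dvd_refl 2)⟩
        refine won_dp_of_curveStep p hp k 1 _ (X 0 ^ r * X 1 ^ s' * U) (by ring) ?_ ?_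
        · have h1 : 1 ≤ r + s' := by
            have := one_le_add_of_not_both_even (r := s') (s := r) (fun h => hpar ⟨h.2, h.1⟩)
            omega
          have hord := PlaneBranchDropOfCount.order_unit_monomial hU r s'
          rw [show U * X 0 ^ r * X 1 ^ s' = X 0 ^ r * X 1 ^ s' * U by ring] at hord
          exact one_le_order_iff_constCoeff_eq_zero.mp (by rw [hord]; exact_mod_cast h1)
        · intro c hc _
          rw [subst_rho_one_unitMonomial,
            show C (c ^ 2) * (X 0 ^ s' * X 1 ^ r * (C (c ^ s') *
                subst (fun l : Fin 2 => if l = 1 then C c * X 0 else (X 1 : MvPowerSeries (Fin 2) k)) U)) =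
              X 0 ^ s' * X 1 ^ r * (C (c ^ 2) * C (c ^ s') *
                subst (fun l : Fin 2 => if l = 1 then C c * X 0 else (X 1 : MvPowerSeries (Fin 2) k)) U) by ring]
          refine ih s' r _ (by omega) ?_ hpar'
          rw [map_mul, map_mul, constantCoeff_C, constantCoeff_C, constantCoeff_subst_rho]
          exact mul_ne_zero (mul_ne_zero (pow_ne_zero _ hc) (pow_ne_zero _ hc)) hU
      · -- the bottom: `r, s ≤ 1`
        have hr1 : r ≤ 1 := by omega
        have hs1 : s ≤ 1 := by omega
        interval_cases r <;> interval_cases s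
        · exact absurd ⟨dvd_zero 2, dvd_zero 2⟩ hpar
        · rw [pow_zero, one_mul, pow_one]
          exact (wonBy_zero_of_not_isSingular (by norm_num) (not_isSingular_dp_linear 1 hU)).won
        · rw [pow_one, pow_zero, mul_one]
          exact (wonBy_zero_of_not_isSingular (by norm_num) (not_isSingular_dp_linear 0 hU)).won
        · exact won_dp_hyperbolic hlow hU

/-! ### The small residual case -/

/-- A series of order `1` vanishes at the origin and has a non-zero linear coefficient. -/
theorem linear_of_order_eq_one {g : MvPowerSeries (Fin 2) k} (hg : g.order = 1) :
    constantCoeff g = 0 ∧ ∃ l : Fin 2, coeff (Finsupp.single l 1) g ≠ 0 := by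
  refine ⟨one_le_order_iff_constCoeff_eq_zero.mp (by rw [hg]), ?_⟩
  obtain ⟨⟨d, hd, hdeg⟩, -⟩ := (order_eq_nat (n := 1)).mp (by exact_mod_cast hg)
  have hdeg1 : d.degree = 1 := by exact_mod_cast hdeg
  rcases FormalCoordChange.eq_zero_or_single_of_degree_lt_two d (by rw [hdeg1]; norm_num) with h0 | ⟨i, rfl⟩
  · rw [h0, map_zero] at hdeg1
    exact absurd hdeg1 zero_ne_one
  · exact ⟨i, hd⟩

/-- THE SMALL RESIDUAL CASE (every characteristic): `y² + x_i^{2(m+1)} · g` with `g(0) = 0` and a non-zero linear coefficient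
of `g` is won.  Induction on `m` along the curve steps at `V(x_i, y)`; at `m = 0` the slice `y² + c² · g(ρ_i)` has a linear term. -/
theorem smallResidualDoublePointWon (p : ℕ) (hp : p.Prime) (k : Type) [Field k] [CharP k p] :
    ∀ (m : ℕ) (i : Fin 2) (g : MvPowerSeries (Fin 2) k), constantCoeff g = 0 →
      (∃ l : Fin 2, coeff (Finsupp.single l 1) g ≠ 0) →
      CobordantGame.Won k 3 (X (Fin.last 2) ^ 2 + rename (Fin.succAboveEmb (Fin.last 2)) (X i ^ (2 * (m + 1)) * g)) := by
  classical
  intro m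
  induction m with
  | zero =>
    intro i g hg0 hg1
    obtain ⟨l, hl⟩ := hg1
    refine won_dp_of_curveStep p hp k i _ g (by ring) hg0 fun c hc hS => ?_
    exfalso
    have hc2 : c ^ 2 ≠ 0 := pow_ne_zero _ hc
    by_cases hli : l = i
    · subst hli
      have h0 := coeff_single_one_eq_zero_of_isSingular hS 0
      rw [coeff_C_mul, coeff_single_zero_subst_rho] at h0
      exact mul_ne_zero hc2 (mul_ne_zero hc hl) h0
    · have h1 := coeff_single_one_eq_zero_of_isSingular hS 1
      rw [coeff_C_mul, coeff_single_one_subst_rho i l hli] at h1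
      exact mul_ne_zero hc2 hl h1
  | succ m ih =>
    intro i g hg0 hg1
    obtain ⟨l, hl⟩ := hg1
    refine won_dp_of_curveStep p hp k i _ (X i ^ (2 * (m + 1)) * g) (by ring) ?_ fun c hc _ => ?_
    · rw [map_mul, hg0, mul_zero]
    · rw [subst_rho_X_pow_mul,
        show C (c ^ 2) * (X 0 ^ (2 * (m + 1)) * (C (c ^ (2 * (m + 1))) *
            subst (fun l : Fin 2 => if l = i then C c * X 0 else (X 1 : MvPowerSeries (Fin 2) k)) g)) =
          X 0 ^ (2 * (m + 1)) * (C (c ^ 2 * c ^ (2 * (m + 1))) *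
            subst (fun l : Fin 2 => if l = i then C c * X 0 else (X 1 : MvPowerSeries (Fin 2) k)) g) by
          rw [map_mul]; ring]
      have hcc : c ^ 2 * c ^ (2 * (m + 1)) ≠ 0 := mul_ne_zero (pow_ne_zero _ hc) (pow_ne_zero _ hc)
      refine ih 0 _ ?_ ?_
      · rw [map_mul, constantCoeff_C, constantCoeff_subst_rho, hg0, mul_zero]
      · by_cases hli : l = i
        · subst hli
          refine ⟨0, ?_⟩
          rw [coeff_C_mul, coeff_single_zero_subst_rho]
          exact mul_ne_zero hcc (mul_ne_zero hc hl)
        · refine ⟨1, ?_⟩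
          rw [coeff_C_mul, coeff_single_one_subst_rho i l hli]
          exact mul_ne_zero hcc hl

end TerminalDoublePoint

open TerminalDoublePoint MvPowerSeries in
/-- THE TERMINAL DOUBLE POINTS ARE WON (every characteristic `p`, every field of characteristic `p`; only the singular germs in
ONE variable are assumed won): `y² + A₀(x₀, x₁)` with `A₀` terminal — binomial `x₀^r x₁^s · U`, `U(0) ≠ 0`, `(r, s) ∉ 2ℕ²`, or
small residual `x_i^{2m} · g`, `m ≥ 1`, `ord g = 1` — is won in the local weighted resolution game. [OURS · L1 W4.3] -/
theorem terminalDoublePointWon (p : ℕ) (hp : p.Prime) (k : Type) [Field k] [CharP k p]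
    (hlow : ∀ g : MvPowerSeries (Fin 1) k, CobordantGame.IsSingular k g → CobordantGame.Won k 1 g)
    (A₀ : MvPowerSeries (Fin 2) k)
    (hT : (∃ (r s : ℕ) (U : MvPowerSeries (Fin 2) k), MvPowerSeries.constantCoeff U ≠ 0 ∧ ¬ (2 ∣ r ∧ 2 ∣ s) ∧
            A₀ = MvPowerSeries.X (0 : Fin 2) ^ r * MvPowerSeries.X (1 : Fin 2) ^ s * U) ∨
          (∃ (i : Fin 2) (m : ℕ) (g : MvPowerSeries (Fin 2) k), 0 < m ∧ g.order = 1 ∧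
            A₀ = MvPowerSeries.X i ^ (2 * m) * g)) :
    CobordantGame.Won k 3 (MvPowerSeries.X (Fin.last 2) ^ 2 +
      MvPowerSeries.rename (Fin.succAboveEmb (Fin.last 2)) A₀) := by
  rcases hT with ⟨r, s, U, hU, hpar, rfl⟩ | ⟨i, m, g, hm, hg, rfl⟩
  · exact binomialDoublePointWon p hp k hlow (r + s) r s U le_rfl hU hpar
  · obtain ⟨m', rfl⟩ : ∃ m', m = m' + 1 := ⟨m - 1, by omega⟩
    obtain ⟨hg0, hg1⟩ := linear_of_order_eq_one hg
    exact smallResidualDoublePointWon p hp k m' i g hg0 hg1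

/-- CORE W″ piece 1i-T (N = 3, p = 2, d = 2, purely inseparable, TERMINAL CASES) — THE TERMINAL CHAR-2 DOUBLE POINTS ARE WON
[OURS · L1 W4.3; stub `stub_charTwoInseparableTerminalWon` of the chain-w43 skeleton draft v21 BY NAME AND SIGNATURE; replaces
the role of the «monomial / small residual» terminal cases of a surface-resolution algorithm; NOT a statement of any manuscript].
Over an algebraically closed field of characteristic `2`, given the singular germs in `≤ 2` variables, the monic germ
`y² + A₀(x₁,x₂)` (`ord A₀ ≥ 3`) is won whenever `A₀` is TERMINAL: MONOMIAL CASE `A₀ = x₁^r · x₂^s · U` with `U(0) ≠ 0` and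
`(r, s) ∉ 2ℕ²`, or SMALL RESIDUAL CASE `A₀ = x_i^{2m} · g` with `m ≥ 1` and `ord g = 1`.  Proof: `terminalDoublePointWon` at
`p = 2` (the hypotheses `ord A₀ ≥ 3`, `k = k̄` and the two-variable germs are not needed). -/
theorem stub_charTwoInseparableTerminalWon : ∀ (k : Type) [Field k] [CharP k 2] [IsAlgClosed k],
      (∀ m : ℕ, m < 3 → ∀ g : MvPowerSeries (Fin m) k,
        CobordantGame.IsSingular k g → CobordantGame.Won k m g) →
      ∀ (A₀ : MvPowerSeries (Fin 2) k), (2 : ℕ∞) < A₀.order →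
        ((∃ (r s : ℕ) (U : MvPowerSeries (Fin 2) k), MvPowerSeries.constantCoeff U ≠ 0 ∧ ¬ (2 ∣ r ∧ 2 ∣ s) ∧
            A₀ = MvPowerSeries.X (0 : Fin 2) ^ r * MvPowerSeries.X (1 : Fin 2) ^ s * U) ∨
          (∃ (i : Fin 2) (m : ℕ) (g : MvPowerSeries (Fin 2) k), 0 < m ∧ g.order = 1 ∧
            A₀ = MvPowerSeries.X i ^ (2 * m) * g)) →
        CobordantGame.Won k 3 (MvPowerSeries.X (Fin.last 2) ^ 2 +
          MvPowerSeries.rename (Fin.succAboveEmb (Fin.last 2)) A₀) :=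
  fun k _ _ _ hlow A₀ _ hT => terminalDoublePointWon 2 Nat.prime_two k (hlow 1 (by norm_num)) A₀ hT

end Summit.ResolutionOfSingularities.ResolutionOfSingularities.Theorems
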